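import Summits.CriticalPhenomena.SAWScalingLimit.Theses.SAWRenewalTightness
import Summits.CriticalPhenomena.SAWScalingLimit.Theses.SAWParafermion
import Summits.CriticalPhenomena.SAWScalingLimit.Theses.SAWLaplacianWalk
import Literature.Probability.RandomPlanarGeometry.LoewnerCotArgExit
import Literature.Probability.RandomPlanarGeometry.SLEKappaRhoSchrammObservable
import Literature.Probability.RandomPlanarGeometry.DrivingFunctionMeasurable
import Literature.Probability.RandomPlanarGeometry.SLELawOfDrivingProcessLocal
import Literature.Probability.RandomPlanarGeometry.ObservableDrivingMartingales
import Literature.Probability.RandomPlanarGeometry.ObservableDiscretePassage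
import Literature.Probability.RandomPlanarGeometry.JordanIndex
import Literature.Probability.LatticeModels.SRWKilledWalkFunctionals
import Summits.CriticalPhenomena.SAWScalingLimit.Theorems.SAWRenewalTightnessRoomEntropyDefs
import Summits.CriticalPhenomena.SAWScalingLimit.Theorems.SAWRenewalTightnessSubseqIdentificationRoomEntropyCharacterisesSLE
import Summits.CriticalPhenomena.SAWScalingLimit.Theorems.SAWRenewalTightnessSubseqIdentificationRoomProfileODE
import Summits.CriticalPhenomena.SAWScalingLimit.Theorems.SAWRenewalTightnessSubseqIdentificationRoomEntropyDrift
import Summits.CriticalPhenomena.SAWScalingLimit.Theorems.SAWRenewalTightnessSubseqIdentificationRoomObsFunctional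
import Summits.CriticalPhenomena.SAWScalingLimit.Theorems.SAWRenewalTightnessSubseqIdentificationPassageUI
import Summits.CriticalPhenomena.SAWScalingLimit.Theorems.SAWRenewalTightnessSubseqIdentificationRoomCylinderToMartingale
import Literature.Probability.LatticeModels.GreenFunctionConformalRadius
import Literature.Probability.RandomPlanarGeometry.LatticeSlitIncrements
import Literature.Probability.LatticeModels.GreenFunctionConformalRadius
import Literature.Probability.RandomPlanarGeometry.LatticeSlitIncrements
import Summits.CriticalPhenomena.SAWScalingLimit.Theorems.SAWRenewalTightnessRoomPassageDefs
import Literature.Probability.LatticeModels.GreenFunctionConformalRadius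
import Literature.Probability.RandomPlanarGeometry.LatticeSlitIncrements
import Summits.CriticalPhenomena.SAWScalingLimit.Theorems.SAWRenewalTightnessRoomPassageDefs
import Summits.CriticalPhenomena.SAWScalingLimit.Theorems.SAWRenewalTightnessRoomPassageEvents
import Summits.CriticalPhenomena.SAWScalingLimit.Theorems.SAWRenewalTightnessSubseqIdentificationRoomEntropyCharacterisesSLECap
import Summits.CriticalPhenomena.SAWScalingLimit.Theorems.SAWRenewalTightnessSubseqIdentificationLatticeRoomDataNRReduction
import Summits.CriticalPhenomena.SAWScalingLimit.Theorems.SAWRenewalTightnessSubseqIdentificationSawNoReturn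
import Literature.Probability.LatticeModels.GridDomainHittingProbability
import HarnessLib

/-!
# Line `room-entropy-wright-fisher` — skeleton for crux `SubseqIdentification` (stmt-CriticalPhenomena-0783)

(Lead reshape r1, prover-line-stmt-CriticalPhenomena-0783-0, 2026-08-16: stub signatures spelled out verbatim
over the vocabulary, landed as `Theorems/SAWRenewalTightnessRoomEntropyDefs.lean` (p78923); statements,
stub set and composition unchanged. Reshape r2: the card's sanity checks F3a/F3b registered as anchor stubs
`stub_roomProfileODE`, `stub_roomEntropyDrift` (not used by the composition); `stub_roomEntropyCharacterisesSLE`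
LANDED as `Theorems/SAWRenewalTightnessSubseqIdentificationRoomEntropyCharacterisesSLE.lean` (p85654 ACCEPTED),
`stub_roomProfileODE` (p86650) and `stub_roomEntropyDrift` (p87759) LANDED; reshape r3: vocabulary opened from the tree
Defs file, the three landed stubs closed by name.

**Reshape r4 (continuation seat prover-line-stmt-CriticalPhenomena-0783-c1-0, 2026-08-16).** The XL transfer
stub `stub_roomMartingaleLimit` (`RoomLawSlit → RoomMartingaleLimit`) is opened up along the tree's PROVED
identification chain for the Ising interfaces (`Loewner.integral_cylinder_eq_zero_of_discreteMartingales`,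
`Process.martingale_natural_of_integral_cylinder`, `LoewnerRoomObservableAdapted`, `LoewnerRoomStopBounds`,
`LoewnerDriverStability`, `LatticeSlitIncrements`):

* new named statement `RoomCylinderIdentity` (the cylinder identity
  `E_μ[(N^{w,m}_t − N^{w,m}_s) ψ(W_{S})] = 0` of the stopped room–entropy observables of a describable
  subsequential limit — the shape in which every lattice-to-SLE passage of the tree is delivered);
* new honest lattice input `RoomDeficitUI` (uniform integrability of the terminal room deficit along
  `δ → 0⁺`; the docstring of `RoomLawSlit` already records that the EXPECTATION form presupposes it: it is
  what turns the exact Doob martingale `n ↦ E_δ[terminal room ∣ γ[0,n]]` into per-scale data with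
  controlled tails on the bad event);
* new lemma statements `RoomObsFunctional` (the stopped observable `(u, W) ↦ N^{w,m}_u(W)` is a bounded,
  jointly continuous functional on `[0, ∞) × C([0, ∞), ℝ)` — the hypothesis `hN`/`hNC` of the abstract
  passage theorem; provable now: driver stability `dist_map_le_of_driving_close` + strict decrease of
  `Im z_t`) and `PassageUI` (the abstract passage theorem
  `integral_cylinder_eq_zero_of_tendstoInDistribution` with the a.e. bounds on the per-scale data replaced
  by integrability + vanishing tails on the bad events; provable now by the same proof);
* stubs: `stub_roomLawSlit` (the bet, unchanged), `stub_roomDeficitUI` (open lattice input),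
  `stub_roomObsFunctional`, `stub_passageUI` (provable now), `stub_roomPassage`
  (`RoomLawSlit → RoomDeficitUI → RoomCylinderIdentity`: the lattice
  potential-theory layer — Kozdron–Lawler 2005 Thms 1.1/1.2, named fact
  `greenFunction_origin_eq_log_conformalRadius` p89220 — and the Loewner bookkeeping of lattice pasts
  through `LatticeSlit.capTime/drivingValue/pastHull`; XL, honest residual of the transfer) and
  `stub_roomCylinderToMartingale` (`RoomCylinderIdentity → RoomMartingaleLimit`; provable now: natural
  filtration of `W = drivingFunction φ`, `adapted_roomObs_min_roomStop`, `abs_roomObs_min_roomStop_le`,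
  `martingale_natural_of_integral_cylinder`).

The composition `SubseqIdentification_of (hR : LimitsDescribable)` stays sorry-free over the stubs.
Reshape r5 (same seat, 12:4xZ): `stub_roomObsFunctional` (p99035), `stub_passageUI` (p101958),
`stub_roomCylinderToMartingale` (p100367) LANDED and closed by name; remaining `sorry`: `stub_roomLawSlit`,
`stub_roomDeficitUI` (open lattice statements) and `stub_roomPassage` (XL).)


**Reshape r6 (same seat, 14:xxZ).** The passage is re-targeted at the TIME-CAPPED observable
`N^{w}_u = roomObsStopped W w ⌈(Im w)²/16⌉₊ (u ∧ (Im w)²/16)` (deterministic cap, CDHKS-style: up to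
`(Im w)²/16` every driver keeps `w` at height `≥ (√3/2) Im w`), because a path-dependent (room-stop)
localisation on the LATTICE side obstructs the measurability clause `V_{S_i} ∈ 𝒢_σ` of the abstract
passage theorem (a walk stopped at its lattice room stop before capacity `s` does not determine its driver
up to time `s`); the far field of the endgame only uses bounded times seen from far points, where the cap is
inactive. New statements `RoomCylinderIdentityCap`, `RoomMartingaleLimitCap`, `RoomEntropyCharacterisesSLECap`
(capped twins of the r4 statements; the r4 stubs `stub_roomCylinderToMartingale` p100367 and
`stub_roomEntropyCharacterisesSLE` p85654 stay landed, superseded as interfaces), `SAWLatticeDrivers`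
(layers (i)–(ii): the lattice past read through `φ` with its stem IS driven by a continuous function —
`DrivesPast`/`latticeDriver` — prefix-consistently, and these drivers converge in law to `drivingFunction φ`
under describable subsequential limits; capacity overshoot and total capacity in probability) and
`LatticeRoomData` (uniform integrability of the deficit + approximation of the exact Doob martingale
`roomDoob` by the hull functional `hullRoomObs` at every capped past — layer (iii), Kozdron–Lawler, from
`RoomLawSlit`). New stubs: `stub_kozdronLawlerGreen` (the named fact p89220 declared as a stub, so that the
composition carries no extra hypothesis), `stub_roomEntropyCharacterisesSLECap` (M/L),
`stub_sawLatticeDrivers` (XL, generic), `stub_latticeRoomData`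
(`greenFunction_origin_eq_log_conformalRadius → RoomLawSlit → RoomDeficitUI → LatticeRoomData`, XL, the
Kozdron–Lawler layer, CONDITIONAL on the named fact p89220 by design), `stub_roomPassageAssembly`
(`SAWLatticeDrivers → LatticeRoomData → RoomMartingaleLimitCap`, L: exploration filtration on the finite SAW
space, Doob/optional sampling, UI ⇒ tails, `PassageUI` with the functional of `RoomObsFunctional`, then the
natural-filtration step of p100367).
The passage vocabulary (`roomObsCap`, `hullDerivRatio/SchrammObs/RoomObs`, `prefixAt`, `DrivesPast`,
`latticeDriver`, `roomDoob`) is proposed as `Theorems/SAWRenewalTightnessRoomPassageDefs.lean` (p103797, in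
review); until it lands this skeleton carries a VERBATIM transitional copy of that file's body (same
namespace), to be replaced by the import. Composition: `SubseqIdentification_of (hR : LimitsDescribable)`.)


**Reshape r6 (same seat, 14:xxZ).** The passage is re-targeted at the TIME-CAPPED observable
`N^{w}_u = roomObsStopped W w ⌈(Im w)²/16⌉₊ (u ∧ (Im w)²/16)` (deterministic cap, CDHKS-style: up to
`(Im w)²/16` every driver keeps `w` at height `≥ (√3/2) Im w`), because a path-dependent (room-stop)
localisation on the LATTICE side obstructs the measurability clause `V_{S_i} ∈ 𝒢_σ` of the abstract
passage theorem (a walk stopped at its lattice room stop before capacity `s` does not determine its driver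
up to time `s`); the far field of the endgame only uses bounded times seen from far points, where the cap is
inactive. New statements `RoomCylinderIdentityCap`, `RoomMartingaleLimitCap`, `RoomEntropyCharacterisesSLECap`
(capped twins of the r4 statements; the r4 stubs `stub_roomCylinderToMartingale` p100367 and
`stub_roomEntropyCharacterisesSLE` p85654 stay landed, superseded as interfaces), `SAWLatticeDrivers`
(layers (i)–(ii): the lattice past read through `φ` with its stem IS driven by a continuous function —
`DrivesPast`/`latticeDriver` — prefix-consistently, and these drivers converge in law to `drivingFunction φ`
under describable subsequential limits; capacity overshoot and total capacity in probability) and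
`LatticeRoomData` (uniform integrability of the deficit + approximation of the exact Doob martingale
`roomDoob` by the hull functional `hullRoomObs` at every capped past — layer (iii), Kozdron–Lawler, from
`RoomLawSlit`). New stubs: `stub_kozdronLawlerGreen` (the named fact p89220 declared as a stub, so that the
composition carries no extra hypothesis), `stub_roomEntropyCharacterisesSLECap` (M/L),
`stub_sawLatticeDrivers` (XL, generic), `stub_latticeRoomData`
(`greenFunction_origin_eq_log_conformalRadius → RoomLawSlit → RoomDeficitUI → LatticeRoomData`, XL, the
Kozdron–Lawler layer, CONDITIONAL on the named fact p89220 by design), `stub_roomPassageAssembly`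
(`SAWLatticeDrivers → LatticeRoomData → RoomMartingaleLimitCap`, L: exploration filtration on the finite SAW
space, Doob/optional sampling, UI ⇒ tails, `PassageUI` with the functional of `RoomObsFunctional`, then the
natural-filtration step of p100367).
The passage vocabulary (`roomObsCap`, `hullDerivRatio/SchrammObs/RoomObs`, `prefixAt`, `DrivesPast`,
`latticeDriver`, `roomDoob`) LANDED as `Theorems/SAWRenewalTightnessRoomPassageDefs.lean` (p103797 ACCEPTED, commit 133d4c7945f2). Composition: `SubseqIdentification_of (hR : LimitsDescribable)`.)


**Reshape r6 (same seat, 13:0xZ; r6b 13:4xZ: stem-capacity clause (2b) added to `SAWLatticeDrivers` after the assembly worker's `stub-misstated`).** The passage is re-targeted at the TIME-CAPPED observable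
`N^{w}_u = roomObsStopped W w ⌈(Im w)²/16⌉₊ (u ∧ (Im w)²/16)` (deterministic cap, CDHKS-style: up to
`(Im w)²/16` every driver keeps `w` at height `≥ (√3/2) Im w`), because a path-dependent (room-stop)
localisation on the LATTICE side obstructs the measurability clause `V_{S_i} ∈ 𝒢_σ` of the abstract
passage theorem (a walk stopped at its lattice room stop before capacity `s` does not determine its driver
up to time `s`); the far field of the endgame only uses bounded times seen from far points, where the cap is
inactive. New statements `RoomCylinderIdentityCap`, `RoomMartingaleLimitCap`, `RoomEntropyCharacterisesSLECap`
(capped twins of the r4 statements; the r4 stubs `stub_roomCylinderToMartingale` p100367 and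
`stub_roomEntropyCharacterisesSLE` p85654 stay landed, superseded as interfaces), `SAWLatticeDrivers`
(layers (i)–(ii): the lattice past read through `φ` with its stem IS driven by a continuous function —
`DrivesPast`/`latticeDriver` — prefix-consistently, and these drivers converge in law to `drivingFunction φ`
under describable subsequential limits; capacity overshoot and total capacity in probability) and
`LatticeRoomData` (uniform integrability of the deficit + approximation of the exact Doob martingale
`roomDoob` by the hull functional `hullRoomObs` at every capped past — layer (iii), Kozdron–Lawler, from
`RoomLawSlit`). New stubs: `stub_kozdronLawlerGreen` (the named fact p89220 declared as a stub, so that the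
composition carries no extra hypothesis), `stub_roomEntropyCharacterisesSLECap` (M/L),
`stub_sawLatticeDrivers` (XL, generic), `stub_latticeRoomData`
(`greenFunction_origin_eq_log_conformalRadius → RoomLawSlit → RoomDeficitUI → LatticeRoomData`, XL, the
Kozdron–Lawler layer, CONDITIONAL on the named fact p89220 by design), `stub_roomPassageAssembly`
(`SAWLatticeDrivers → LatticeRoomData → RoomMartingaleLimitCap`, L: exploration filtration on the finite SAW
space, Doob/optional sampling, UI ⇒ tails, `PassageUI` with the functional of `RoomObsFunctional`, then the
natural-filtration step of p100367).
The passage vocabulary (`roomObsCap`, `hullDerivRatio/SchrammObs/RoomObs`, `prefixAt`, `DrivesPast`,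
`latticeDriver`, `roomDoob`) LANDED as `Theorems/SAWRenewalTightnessRoomPassageDefs.lean` (p103797 ACCEPTED, commit 133d4c7945f2). Composition: `SubseqIdentification_of (hR : LimitsDescribable)`.)

**Reshape r7 (same seat, 19:xxZ).** The drivers worker REFUTED conjunct (1) of `SAWLatticeDrivers`
(`stub-false`, explicit unit-disc witness; Literature p116045 `LatticeSlitStemCapacity`, p116223
`LatticeSlitSwallowedSteps`): a walk crossing the image of its stem swallows a pocket, pasts inside the
pocket share hull and capacity but not driving value, so the exact predicate `DrivesPast` at EVERY past is
unsatisfiable and `latticeDriver = 0` (junk) on a set of non-vanishing mass; prefix-consistency fails too;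
microscopic stem crossings near the root are common. A formulation pass (crux evidence `H1_formulation`)
then fixed the architecture: (H1) becomes `SAWLatticeDriversApprox` — along a describable mesh sequence
with NO RETURN to the root (`NoReturnAlong`), for every tolerance `ρ` a threshold `S₀ ≤ ρ` and drivers `𝒱`
that are EXACTLY prefix-consistent beyond capacity `S₀`, converge in law to the frozen limit driver
`frozenDriver φ S₀` (`u ↦ W_{u ∨ S₀}`), have fidelity bad events (`fidelityEvent`: capped observable of
`𝒱 γ` vs. `hullRoomObs K_n ξ_n w` at pasts with `S₀ ≤ capacity ≤ (Im w)²/16`, `Im w ≥ ρ`) of probability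
`≤ ρ`, and capacity bad events (`capacityEvent`) of vanishing probability (construction: constant `ξ_j` up
to the first passage `j` of `S₀` — a fake vertical slit of the same capacity — then the honest conjugated
slit transform; error `O((S₀/Im w²) log)` from the capacity-displacement bound, NOT from `diam K_j`);
(H2) becomes `LatticeRoomDataNR` — the approximation of `roomDoob` by the hull functional at pasts of
capacity `≤ (Im w)²/16` along which the walk has not returned to `B(a, r)` after leaving `B(a, R)`
(`roomDataEvent`; stem-honesty alone was TRUE but INSUFFICIENT); the no-return input is the new stub
`stub_sawNoReturn : LimitsDescribable → …` (lattice reversal symmetry + describability of the reversed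
limit in the swapped domain: a described class reaches its target only at the final time); the assembly
becomes `stub_roomPassageAssemblyNR` (per-`ρ` passage with the frozen limit driver and `O(ρ)` defects —
a ~15-line corollary of the PROOF of p101958 — or diagonalisation, then `ρ → 0` by continuity of the
functional in the driver). `stub_roomEntropyCharacterisesSLECap` LANDED (p105444); the stem clause landed
as `stub_sawLatticeDriversStemCapacity` (p116522); the r6b assembly p114096 stays as a (vacuous-hypothesis)
theorem whose helpers (p107641 p107758 p113465 p108629 p107993 p113271 p108480) carry over. Vocabulary
of r7: `Theorems/SAWRenewalTightnessRoomPassageEvents.lean` (events, `WeakLimitAlong`, `NoReturnAlong`,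
`frozenDriver`).)

**Reshape r8 (same seat).** `stub_sawNoReturn` LANDED (p118403) and `stub_roomPassageAssemblyNR` LANDED (p119422,
route (ii) diagonalisation; Literature p118934 `DiagonalPassage`, p119224 `SAWExplorationRunningMax`). The (H2) worker
reported `stub-misstated` with an explicit witness (pasts whose polyline passes THROUGH `b`: capacity `0` in scope, junk
hull functional, macroscopic `roomDoob`; finite-energy positive probability) and LANDED the reduction p120877
(`roomDataEventPos`, `latticeRoomDataNR_of_parts`), p121916 (`nearPastEvent_small_of_degenerate`), Literature
p120982 p121529 p121172 (LSW04 grid-domain hitting facts `hittingProbability_ratio_poissonKernel`,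
`boundaryHitting`, named, unproved): (H2) is now `LatticeRoomDataNRPos` (guarded event `roomDataEventPos`: positive
capacity, whole-walk no-return condition) from the three named lattice-potential facts (declared as ONE stub
`stub_latticePotentialFacts`), the degeneracy lemma `stub_degeneratePastCapacity` (`b` on the polyline ⇒ capacity
`0`; provable now: Newman crosscut + Carathéodory), `RoomLawSlit`, `RoomDeficitUI`; the assembly is re-registered as
`stub_roomPassageAssemblyNRPos` (p119422 with `roomDataEventPos`: thread `0 < S₀`, drop the `k ≤ n` binder).)

Crux (route `SAWRenewalTightness`, rank 5; shared verbatim by `SAWParafermion` (r3),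
`SAWLeftRightFKG`, `SAWAsymptoticMorera`): every probability subsequential weak limit `μ` of the
critical `δℤ²` SAW laws in a Dobrushin domain `(D; a, b)` along meshes `s n → 0⁺` is the chordal
SLE(8/3) law of `D`.

Idea (card `Ideas/room-entropy-wright-fisher.md`, triage r1-1/2/3: pass ×3). THE ROOM OF A POINT.
For an interior point `z` the *room* left by the polymer is the diagonal Green function of an
independent simple random walk killed by the walk: on the lattice the **room deficit**
`(π/2)·[G_{Ω_δ}(z,z) − G_{Ω_δ∖γ[0,n]}(z,z)]` (a DIFFERENCE of two killed Green functions at the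
same site: the potential-kernel constant `(2/π) log δ⁻¹ + k₀` cancels, dimension 0, monotone in
the past, no normalisation point) is the lattice avatar of the log-conformal-radius loss
`log ψ_t(w)` (`Loewner.derivRatio`, Rohde–Schramm's ratio), and the exact Doob martingale
`n ↦ E_δ[terminal room ∣ γ[0,n]]` is, by the configurational domain-Markov property of the
weight `x_c^{|γ|}`, the expected-terminal-room one-point function of the slit domain. The κ = 8/3
prediction for its profile is closed-form and entropy-shaped — expected log-conformal-radius loss
seen from `w` at conformal angle `θ` equals `Λ(θ) = 3·H(sin²(θ/2))` (`H` = binary entropy in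
nats) — so that `N_t(w) := log ψ_t(w) + 3·H(S_t(w))` (`S_t` = Schramm's observable
`Loewner.schrammObs = cos²(arg z_t/2)`, and `H(cos²) = H(sin²)`: ORIENTATION-FREE) is a local
martingale exactly at `κ = 8/3` (drift `∝ (3κ − 8)`).

Shape of the line after r4 (six registered stubs, composition `SubseqIdentification_of` sorry-free over
them and over the shared route item `SAWLaplacianWalk.LimitsDescribable` taken BY NAME as a hypothesis):

* `stub_roomLawSlit : RoomLawSlit` — THE BET (lattice, open, hardest).
* `stub_roomDeficitUI : RoomDeficitUI` — lattice input (open; uniform integrability of the terminal deficit).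
* `stub_roomObsFunctional : RoomObsFunctional` — deterministic Loewner (LANDED p99035).
* `stub_passageUI : PassageUI` — abstract probability (LANDED p101958).
* `stub_roomPassage : RoomLawSlit → RoomDeficitUI → RoomCylinderIdentity`
  (XL: lattice potential theory + Loewner bookkeeping of lattice pasts + the abstract passage; its proof
  consumes the two lemma stubs through their landed files).
* `stub_roomCylinderToMartingale : RoomCylinderIdentity → RoomMartingaleLimit` (LANDED p100367).
* landed: `stub_roomEntropyCharacterisesSLE : RoomEntropyCharacterisesSLE` (p85654), anchors
  `stub_roomProfileODE` (p86650), `stub_roomEntropyDrift` (p87759).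
* hypothesis `LimitsDescribable` (stmt-CriticalPhenomena-4481; NECESSARY for the crux,
  `Negative/DescribabilityNecessity` p78136).

Disproof used (`Cruxes/SubseqIdentification/Disproof.lean`, cdisprove cycle 2 v8, NO KILL):
`subseqIdentification_false_without_endpointLimits/_fstLimit/_sndLimit` — honoured: every stub about SAW
laws keeps `IsEndpointApprox` whole; `_false_without_oneSided/_meshToZero` — honoured: all lattice clauses
are `∀ᶠ δ in 𝓝[>] 0`; §1c (`IsProbabilityMeasure μ` derivable) — carried verbatim, harmless; §3
`ae_endpoints_of_hyps`, `ae_range_subset_closure_of_hyps` — available to the prover of `stub_roomPassage`;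
§4.7 (embedding sensitivity) — answered inside `stub_roomPassage` (isotropic invariance principle of the SRW
behind Kozdron–Lawler) and nowhere else; §6b — `LimitsDescribable` is necessary. No `-- Targets` section bears
on this line's stubs.
-/

noncomputable section

open MeasureTheory Filter Topology Set
open scoped NNReal ENNReal Classical BigOperators
open Literature.Probability.LatticeModels
open Literature.Probability.RandomPlanarGeometry
open UpperHalfPlane (upperHalfPlaneSet)

/-! ## Vocabulary

Room–entropy objects: `Theorems/SAWRenewalTightnessRoomEntropyDefs.lean` (p78923); passage objects:
`Theorems/SAWRenewalTightnessRoomPassageDefs.lean` (p103797); events / weak-limit-along / no-return /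
frozen driver: `Theorems/SAWRenewalTightnessRoomPassageEvents.lean` (r7). All opened below. -/

open scoped PathBorel
open Summit.CriticalPhenomena.SAWScalingLimit.Theses.SAWRenewalTightness (SubseqIdentification)
open Summit.CriticalPhenomena.SAWScalingLimit.Theses.SAWLaplacianWalk (LimitsDescribable)
open Literature.Probability.LatticeModels (greenFunction_origin_eq_log_conformalRadius)

namespace Summit.CriticalPhenomena.SAWScalingLimit.Cruxes.SubseqIdentification.RoomEntropyWrightFisher

open Summit.CriticalPhenomena.SAWScalingLimit.Theorems.SubseqIdentification.RoomEntropy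

/-! ## The named statements of the line (r8) -/

/-- **The room–entropy law in slit domains, in probability along the past** (lattice crux of the line;
OPEN — the bet). -/
def RoomLawSlit : Prop :=
  ∀ (D : DobrushinDomain) (a b : ℝ → Site 2), SAW.IsEndpointApprox D a b →
      ∀ z ∈ D.carrier, ∀ (zδ : ℝ → Site 2),
        Tendsto (fun δ => meshPoint δ (zδ δ)) (𝓝[>] (0 : ℝ)) (𝓝 z) →
      ∀ r ε : ℝ, 0 < r → 0 < ε →
      ∀ᶠ δ in 𝓝[>] (0 : ℝ),
        SAW.law D.carrier δ (a δ) (b δ)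
            {γ | ∃ (w : Site 2) (hw : w ∈ γ.walk.support),
              (∀ v ∈ (γ.walk.takeUntil w hw).support, r ≤ dist (meshPoint δ v) z) ∧
              ε < |condRoom D.carrier δ (a δ) (b δ) (zδ δ) (γ.walk.takeUntil w hw)
                    - roomAt D.carrier δ (verts (γ.walk.takeUntil w hw)) (zδ δ)
                    + (2 / Real.pi) * roomProfile (sideAngle D δ (γ.walk.takeUntil w hw) (zδ δ) z)|}
          ≤ ENNReal.ofReal ε

/-- **Uniform integrability of the terminal room deficit** along `δ → 0⁺` (lattice INPUT, open). -/
def RoomDeficitUI : Prop :=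
  ∀ (D : DobrushinDomain) (a b : ℝ → Site 2), SAW.IsEndpointApprox D a b →
      ∀ z ∈ D.carrier, ∀ (zδ : ℝ → Site 2),
        Tendsto (fun δ => meshPoint δ (zδ δ)) (𝓝[>] (0 : ℝ)) (𝓝 z) →
      ∀ ε : ℝ, 0 < ε → ∃ R : ℝ, ∀ᶠ δ in 𝓝[>] (0 : ℝ),
        ∫ γ in {γ : SAW.DomainSAW D.carrier δ (a δ) (b δ) |
                  R < roomAt D.carrier δ ∅ (zδ δ) - roomAt D.carrier δ (verts γ.walk) (zδ δ)},
            (roomAt D.carrier δ ∅ (zδ δ) - roomAt D.carrier δ (verts γ.walk) (zδ δ))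
          ∂(SAW.law D.carrier δ (a δ) (b δ)) ≤ ε

/-- **Approximate lattice drivers (H1, r7)** — see the reshape-r7 paragraph of the module docstring:
along a describable mesh sequence with no return to the root, for every `ρ > 0` a threshold `S₀ ≤ ρ` and a
driver assignment `𝒱` that is exactly prefix-consistent beyond capacity `S₀`, converges in law to
`frozenDriver φ S₀`, and has `ρ`-small fidelity bad events (`Im w ≥ ρ`) and vanishing capacity bad events.
TRUE (formulation audit): consistency by causal construction; convergence by the extended mapping theorem
+ KS A.2 capacity convergence + the Wolff/length–area driving modulus; fidelity by the cocycle
`g_{K_k} = g_{L_k} ∘ g_{K_j}`, the capacity-displacement bound `|g_A z − z| ≤ hcap(A)/Im g_A z` and Cauchy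
estimates; capacity facts by `hcap` continuity under thickening. -/
def SAWLatticeDriversApprox : Prop :=
  ∀ (D : DobrushinDomain) (a b : ℝ → Site 2) (φ : ConformalEquiv upperHalfPlaneSet D.carrier),
      SAW.IsEndpointApprox D a b → D.IsChordalUniformizing φ →
      ∀ ρ : ℝ, 0 < ρ → ∀ (μ : Measure (CurveClass ℂ)) (s : ℕ → ℝ) [IsProbabilityMeasure μ]
        [∀ n, IsProbabilityMeasure (SAW.law D.carrier (s n) (a (s n)) (b (s n)))],
        Tendsto s atTop (𝓝[>] (0 : ℝ)) → WeakLimitAlong D a b μ s →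
        (∀ᵐ c ∂μ, IsLoewnerDescribable φ c ∧ c.source = D.pt 0) → NoReturnAlong D a b s →
        ∃ S₀ : ℝ≥0, 0 < S₀ ∧ (S₀ : ℝ) ≤ ρ ∧
        ∃ 𝒱 : (δ : ℝ) → SAW.DomainSAW D.carrier δ (a δ) (b δ) → C(ℝ≥0, ℝ),
          (∀ᶠ n in atTop, ∀ (γ γ' : SAW.DomainSAW D.carrier (s n) (a (s n)) (b (s n))) (k : ℕ),
            (prefixAt γ k).support = (prefixAt γ' k).support →
            (S₀ : ℝ) ≤ LatticeSlit.capTime φ (prefixAt γ k) →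
            ∀ u : ℝ≥0, (u : ℝ) ≤ LatticeSlit.capTime φ (prefixAt γ k) →
              𝒱 (s n) γ u = 𝒱 (s n) γ' u) ∧
          TendstoInDistribution (fun n γ => 𝒱 (s n) γ) atTop (frozenDriver φ S₀)
            (fun n => SAW.law D.carrier (s n) (a (s n)) (b (s n))) μ ∧
          (∀ w : ℂ, ρ ≤ w.im → ∀ᶠ n in atTop,
            SAW.law D.carrier (s n) (a (s n)) (b (s n)) (fidelityEvent φ (𝒱 (s n)) S₀ w ρ)
              ≤ ENNReal.ofReal ρ) ∧
          ∀ T ε : ℝ, 0 < ε → ∀ᶠ n in atTop,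
            SAW.law D.carrier (s n) (a (s n)) (b (s n)) (capacityEvent φ T ε) ≤ ENNReal.ofReal ε

/-- **Lattice room data with the guarded event (H2, r8)** at a point `w ∈ ℍ` with lattice points
`z_δ → φ w`: (1) uniform integrability of the terminal deficit (pass-through of `RoomDeficitUI`); (2) for
every `ε` a scale `R` such that for all `0 < r < R` and all small `δ`, with probability `≥ 1 − ε`, at every
past of capacity `≤ (Im w)²/16` along which the walk has not re-entered `B(a, r)` after leaving `B(a, R)`
the exact Doob martingale `roomDoob` is within `ε` of the hull functional `hullRoomObs K_n ξ_n w`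
(Kozdron–Lawler Thm 1.2 at an interior point; exit distribution vs. harmonic measure of the fattened
slit's sides; pockets against the stem then lie in `B(a, R)` and cost `O(osc_R)`; deterministic lattice
potential theory given `RoomLawSlit`). -/
def LatticeRoomDataNRPos : Prop :=
  ∀ (D : DobrushinDomain) (a b : ℝ → Site 2) (φ : ConformalEquiv upperHalfPlaneSet D.carrier),
      SAW.IsEndpointApprox D a b → D.IsChordalUniformizing φ →
      ∀ w : ℂ, 0 < w.im → ∀ (zδ : ℝ → Site 2),
        Tendsto (fun δ => meshPoint δ (zδ δ)) (𝓝[>] (0 : ℝ)) (𝓝 (φ w)) →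
      (∀ ε : ℝ, 0 < ε → ∃ R : ℝ, ∀ᶠ δ in 𝓝[>] (0 : ℝ),
        ∫ γ in {γ : SAW.DomainSAW D.carrier δ (a δ) (b δ) |
                  R < roomAt D.carrier δ ∅ (zδ δ) - roomAt D.carrier δ (verts γ.walk) (zδ δ)},
            (roomAt D.carrier δ ∅ (zδ δ) - roomAt D.carrier δ (verts γ.walk) (zδ δ))
          ∂(SAW.law D.carrier δ (a δ) (b δ)) ≤ ε) ∧
      ∀ ε : ℝ, 0 < ε → ∃ R : ℝ, 0 < R ∧ ∀ r : ℝ, 0 < r → r < R → ∀ᶠ δ in 𝓝[>] (0 : ℝ),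
        SAW.law D.carrier δ (a δ) (b δ) (roomDataEventPos D φ δ (a δ) (b δ) (zδ δ) w R r ε)
          ≤ ENNReal.ofReal ε

/-- **Degenerate pasts have capacity zero** (r8): if the polyline of a past passes through `b = D.pt 1 = φ(∞)`,
its pulled-back trace is unbounded, `ℍ ∖ pastHull` is disconnected, there is no hydrodynamic map and
`LatticeSlit.capTime = 0` (junk of `hcapOf`). Provable now (Newman crosscut theorem + Carathéodory extension). -/
def DegeneratePastCapacity : Prop :=
  ∀ (D : DobrushinDomain) (a b : ℝ → Site 2) (φ : ConformalEquiv upperHalfPlaneSet D.carrier),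
      SAW.IsEndpointApprox D a b → D.IsChordalUniformizing φ → ∀ᶠ δ in 𝓝[>] (0 : ℝ),
        ∀ (γ : SAW.DomainSAW D.carrier δ (a δ) (b δ)) (n : ℕ),
          D.pt 1 ∈ Set.range ((prefixAt γ n).toCurve (meshPoint δ)) →
          LatticeSlit.capTime φ (prefixAt γ n) = 0

/-- **The three named lattice-potential-theory facts** consumed by the Kozdron–Lawler layer (r8):
Kozdron–Lawler 2005 Thm 1.2 (p89220) and Lawler–Schramm–Werner 2004 Prop. 2.2 / Lemma 5.3 on grid domains
(p121172) — all UNPROVED in the tree. -/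
def LatticePotentialFacts : Prop :=
  greenFunction_origin_eq_log_conformalRadius ∧
      Literature.Probability.LatticeModels.hittingProbability_ratio_poissonKernel ∧
      Literature.Probability.LatticeModels.boundaryHitting

/-- **No return to the root along describable mesh sequences** (r7): for every Dobrushin domain with an
endpoint approximation and every probability weak limit `μ` of the SAW curve laws along `s_n → 0⁺`, the
walks do not come back within `r` of `a` after having been at distance `≥ R`, except with probability
`≤ ε`, for large `n` (`NoReturnAlong`). Derived from `LimitsDescribable` through the lattice reversal
symmetry of the SAW law (`Negative/ReversalLattice`) and describability of the reversed limit in the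
swapped domain: a described class reaches its target only at the final time. -/
def SAWNoReturn : Prop :=
  ∀ (D : DobrushinDomain) (a b : ℝ → Site 2), SAW.IsEndpointApprox D a b →
      ∀ (μ : Measure (CurveClass ℂ)) (s : ℕ → ℝ), IsProbabilityMeasure μ →
        Tendsto s atTop (𝓝[>] (0 : ℝ)) → WeakLimitAlong D a b μ s → NoReturnAlong D a b s

/-- **The cylinder identity of the time-capped room–entropy observables of a describable subsequential
limit** (intermediate of the assembly). -/
def RoomCylinderIdentityCap : Prop :=
  ∀ (D : DobrushinDomain) (a b : ℝ → Site 2)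
      (φ : ConformalEquiv upperHalfPlaneSet D.carrier) (μ : Measure (CurveClass ℂ)),
      SAW.IsEndpointApprox D a b → D.IsChordalUniformizing φ → IsProbabilityMeasure μ →
      IsSubseqLimitLaw (fun δ (γ : SAW.DomainSAW D.carrier δ (a δ) (b δ)) => γ.curve)
        (fun δ => SAW.law D.carrier δ (a δ) (b δ)) μ →
      (∀ᵐ c ∂μ, IsLoewnerDescribable φ c ∧ c.source = D.pt 0) →
      ∀ w : ℂ, 0 < w.im → ∀ (s t : ℝ≥0), s ≤ t → ∀ (n : ℕ) (S : Fin n → ℝ≥0), (∀ k, S k ≤ s) →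
        ∀ ψ : (Fin n → ℝ) → ℝ, Continuous ψ → (∀ v, |ψ v| ≤ 1) →
          ∫ c, (roomObsStopped (drivingFunction φ c) w ⌈w.im ^ 2 / 16⌉₊ (min t (Real.toNNReal (w.im ^ 2 / 16))) -
                roomObsStopped (drivingFunction φ c) w ⌈w.im ^ 2 / 16⌉₊ (min s (Real.toNNReal (w.im ^ 2 / 16)))) *
              ψ (fun k => drivingFunction φ c (S k)) ∂μ = 0

/-- **The time-capped room–entropy martingales of a describable subsequential limit**. -/
def RoomMartingaleLimitCap : Prop :=
  ∀ (D : DobrushinDomain) (a b : ℝ → Site 2)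
      (φ : ConformalEquiv upperHalfPlaneSet D.carrier) (μ : Measure (CurveClass ℂ)),
      SAW.IsEndpointApprox D a b → D.IsChordalUniformizing φ → IsProbabilityMeasure μ →
      IsSubseqLimitLaw (fun δ (γ : SAW.DomainSAW D.carrier δ (a δ) (b δ)) => γ.curve)
        (fun δ => SAW.law D.carrier δ (a δ) (b δ)) μ →
      (∀ᵐ c ∂μ, IsLoewnerDescribable φ c ∧ c.source = D.pt 0) →
      ∃ 𝓕 : Filtration ℝ≥0 (inferInstance : MeasurableSpace (CurveClass ℂ)),
        Adapted 𝓕 (fun t c => drivingFunction φ c t) ∧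
        ∀ w : ℂ, 0 < w.im →
          Martingale (fun t c => roomObsStopped (drivingFunction φ c) w ⌈w.im ^ 2 / 16⌉₊ (min t (Real.toNNReal (w.im ^ 2 / 16)))) 𝓕 μ

/-- **The time-capped room–entropy martingales characterise SLE(8/3)** (capped endgame, LANDED p105444). -/
def RoomEntropyCharacterisesSLECap : Prop :=
  ∀ (D : DobrushinDomain) (φ : ConformalEquiv upperHalfPlaneSet D.carrier)
      (ν : Measure (CurveClass ℂ)),
      D.IsChordalUniformizing φ → IsProbabilityMeasure ν →
      (∀ᵐ c ∂ν, IsLoewnerDescribable φ c ∧ c.source = D.pt 0) →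
      ∀ 𝓕 : Filtration ℝ≥0 (inferInstance : MeasurableSpace (CurveClass ℂ)),
        Adapted 𝓕 (fun t c => drivingFunction φ c t) →
        (∀ w : ℂ, 0 < w.im →
          Martingale (fun t c => roomObsStopped (drivingFunction φ c) w ⌈w.im ^ 2 / 16⌉₊ (min t (Real.toNNReal (w.im ^ 2 / 16)))) 𝓕 ν) →
      IsSLELaw ((8 : ℝ≥0) / 3) D ν

/-! ## Stubs (registered; `sorry` only here) -/

/-- STUB 1 (OPEN — the line's bet; hardest; held by the lead). `RoomLawSlit`. Numerics PASS (drefute F1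
κ-meter 2.62 ± 0.04; lead -0 half-plane F1/F2). No lattice mechanism known. -/
theorem stub_roomLawSlit :
    ∀ (D : DobrushinDomain) (a b : ℝ → Site 2), SAW.IsEndpointApprox D a b →
      ∀ z ∈ D.carrier, ∀ (zδ : ℝ → Site 2),
        Tendsto (fun δ => meshPoint δ (zδ δ)) (𝓝[>] (0 : ℝ)) (𝓝 z) →
      ∀ r ε : ℝ, 0 < r → 0 < ε →
      ∀ᶠ δ in 𝓝[>] (0 : ℝ),
        SAW.law D.carrier δ (a δ) (b δ)
            {γ | ∃ (w : Site 2) (hw : w ∈ γ.walk.support),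
              (∀ v ∈ (γ.walk.takeUntil w hw).support, r ≤ dist (meshPoint δ v) z) ∧
              ε < |condRoom D.carrier δ (a δ) (b δ) (zδ δ) (γ.walk.takeUntil w hw)
                    - roomAt D.carrier δ (verts (γ.walk.takeUntil w hw)) (zδ δ)
                    + (2 / Real.pi) * roomProfile (sideAngle D δ (γ.walk.takeUntil w hw) (zδ δ) z)|}
          ≤ ENNReal.ofReal ε := by
  sorry

/-- STUB 2 (r4; OPEN lattice input). `RoomDeficitUI`. -/
theorem stub_roomDeficitUI :
    ∀ (D : DobrushinDomain) (a b : ℝ → Site 2), SAW.IsEndpointApprox D a b →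
      ∀ z ∈ D.carrier, ∀ (zδ : ℝ → Site 2),
        Tendsto (fun δ => meshPoint δ (zδ δ)) (𝓝[>] (0 : ℝ)) (𝓝 z) →
      ∀ ε : ℝ, 0 < ε → ∃ R : ℝ, ∀ᶠ δ in 𝓝[>] (0 : ℝ),
        ∫ γ in {γ : SAW.DomainSAW D.carrier δ (a δ) (b δ) |
                  R < roomAt D.carrier δ ∅ (zδ δ) - roomAt D.carrier δ (verts γ.walk) (zδ δ)},
            (roomAt D.carrier δ ∅ (zδ δ) - roomAt D.carrier δ (verts γ.walk) (zδ δ))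
          ∂(SAW.law D.carrier δ (a δ) (b δ)) ≤ ε := by
  sorry

/-- STUB F (r8; literature debt declared as ONE stub so that the composition has no extra hypothesis): the
three named facts `greenFunction_origin_eq_log_conformalRadius` (Kozdron–Lawler 2005 Thm 1.2, p89220),
`hittingProbability_ratio_poissonKernel`, `boundaryHitting` (Lawler–Schramm–Werner 2004 Prop. 2.2, Lemma 5.3, p121172),
all UNPROVED in the tree. Consumed by `stub_latticeRoomDataNR`. -/
theorem stub_latticePotentialFacts :
    greenFunction_origin_eq_log_conformalRadius ∧
      Literature.Probability.LatticeModels.hittingProbability_ratio_poissonKernel ∧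
      Literature.Probability.LatticeModels.boundaryHitting := by
  sorry

/-- STUB J (r8; M, provable now). `DegeneratePastCapacity`: `b` on the polyline of the past ⇒ the pulled-back trace
runs through `∞`, `ℍ ∖ pastHull` is disconnected (`Newman1939_crosscut_holds`), `¬ HasHydroMap`, `hcapOf = 0`
(`hcapOf_of_not`), `capTime = 0`. Leans on: `LatticeSlitBoundaryTouching` (p121529), `LatticeSlitCapacityHeight`
(p120982), `JordanDomain.exists_continuousOn_extension`. -/
theorem stub_degeneratePastCapacity :
    ∀ (D : DobrushinDomain) (a b : ℝ → Site 2) (φ : ConformalEquiv upperHalfPlaneSet D.carrier),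
      SAW.IsEndpointApprox D a b → D.IsChordalUniformizing φ → ∀ᶠ δ in 𝓝[>] (0 : ℝ),
        ∀ (γ : SAW.DomainSAW D.carrier δ (a δ) (b δ)) (n : ℕ),
          D.pt 1 ∈ Set.range ((prefixAt γ n).toCurve (meshPoint δ)) →
          LatticeSlit.capTime φ (prefixAt γ n) = 0 := by
  sorry

/-- STUB 5'' (r7; XL, generic lattice Loewner theory). `SAWLatticeDriversApprox`. Construction and
proof plan: `Cruxes/SubseqIdentification/H1_formulation.md` (crux evidence). Leans on: `LatticeSlit.*`,
`LatticeSlitSwallowedSteps`, `LatticeSlitStemCapacity`, `exists_continuous_driving_of_slit`,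
`IsPlusSlit.hull_driving_of_le/driving_initial`, `SlitLanding.tendsto_landing`, `Loewner.map_add`,
`Loewner.hull_add_sdiff_eq_image` (`LoewnerHullCocycle`), `LoewnerHullReadout`,
`tendsto_hcap_image_Icc_of_tendstoUniformlyOn` (KS A.2), `Loewner.IsGeneratedByCurve.abs_driving_sub_driving_le_of_modulus`
(`LoewnerDrivingModulus`), `Loewner.isGeneratedByCurve_of_tendstoLocallyUniformly'`,
`IsLoewnerDescribed.driving_unique_holds`, `Process.tendstoInDistribution_comp_of_forall_exists_seq_tendsto`,
`HullHausdorffCapacity` (`tendsto_hcap_of_thickening`), `HydrodynamicDisplacement`, `LengthAreaDiameter`. -/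
theorem stub_sawLatticeDriversApprox :
    ∀ (D : DobrushinDomain) (a b : ℝ → Site 2) (φ : ConformalEquiv upperHalfPlaneSet D.carrier),
      SAW.IsEndpointApprox D a b → D.IsChordalUniformizing φ →
      ∀ ρ : ℝ, 0 < ρ → ∀ (μ : Measure (CurveClass ℂ)) (s : ℕ → ℝ) [IsProbabilityMeasure μ]
        [∀ n, IsProbabilityMeasure (SAW.law D.carrier (s n) (a (s n)) (b (s n)))],
        Tendsto s atTop (𝓝[>] (0 : ℝ)) → WeakLimitAlong D a b μ s →
        (∀ᵐ c ∂μ, IsLoewnerDescribable φ c ∧ c.source = D.pt 0) → NoReturnAlong D a b s →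
        ∃ S₀ : ℝ≥0, 0 < S₀ ∧ (S₀ : ℝ) ≤ ρ ∧
        ∃ 𝒱 : (δ : ℝ) → SAW.DomainSAW D.carrier δ (a δ) (b δ) → C(ℝ≥0, ℝ),
          (∀ᶠ n in atTop, ∀ (γ γ' : SAW.DomainSAW D.carrier (s n) (a (s n)) (b (s n))) (k : ℕ),
            (prefixAt γ k).support = (prefixAt γ' k).support →
            (S₀ : ℝ) ≤ LatticeSlit.capTime φ (prefixAt γ k) →
            ∀ u : ℝ≥0, (u : ℝ) ≤ LatticeSlit.capTime φ (prefixAt γ k) →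
              𝒱 (s n) γ u = 𝒱 (s n) γ' u) ∧
          TendstoInDistribution (fun n γ => 𝒱 (s n) γ) atTop (frozenDriver φ S₀)
            (fun n => SAW.law D.carrier (s n) (a (s n)) (b (s n))) μ ∧
          (∀ w : ℂ, ρ ≤ w.im → ∀ᶠ n in atTop,
            SAW.law D.carrier (s n) (a (s n)) (b (s n)) (fidelityEvent φ (𝒱 (s n)) S₀ w ρ)
              ≤ ENNReal.ofReal ρ) ∧
          ∀ T ε : ℝ, 0 < ε → ∀ᶠ n in atTop,
            SAW.law D.carrier (s n) (a (s n)) (b (s n)) (capacityEvent φ T ε) ≤ ENNReal.ofReal ε := by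
  sorry

/-- STUB 7a3 (r8; XL; the Kozdron–Lawler layer, corrected signature of the (H2) worker — CONDITIONAL on the
three named facts and the degeneracy lemma by design; reduction LANDED p120877 `latticeRoomDataNR_of_parts`, near-past
part LANDED p121916; what remains: the Green part (`greenPartEvent` small: KL Thm 1.2 twice + conformal-radius ratio
comparison, bridge `slitGraph` ↔ site graph of a hole-free set) and the angle part (`anglePartEvent` small: LSW04 facts
+ Wolff/Beurling, `JordanDomain.index` orientation, `Λ(θ) = Λ(π − θ)`). -/
theorem stub_latticeRoomDataNR :
    greenFunction_origin_eq_log_conformalRadius →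
    Literature.Probability.LatticeModels.hittingProbability_ratio_poissonKernel →
    Literature.Probability.LatticeModels.boundaryHitting →
    (∀ (D : DobrushinDomain) (a b : ℝ → Site 2) (φ : ConformalEquiv upperHalfPlaneSet D.carrier),
      SAW.IsEndpointApprox D a b → D.IsChordalUniformizing φ → ∀ᶠ δ in 𝓝[>] (0 : ℝ),
        ∀ (γ : SAW.DomainSAW D.carrier δ (a δ) (b δ)) (n : ℕ),
          D.pt 1 ∈ Set.range ((prefixAt γ n).toCurve (meshPoint δ)) →
          LatticeSlit.capTime φ (prefixAt γ n) = 0) →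
    (∀ (D : DobrushinDomain) (a b : ℝ → Site 2), SAW.IsEndpointApprox D a b →
      ∀ z ∈ D.carrier, ∀ (zδ : ℝ → Site 2),
        Tendsto (fun δ => meshPoint δ (zδ δ)) (𝓝[>] (0 : ℝ)) (𝓝 z) →
      ∀ r ε : ℝ, 0 < r → 0 < ε →
      ∀ᶠ δ in 𝓝[>] (0 : ℝ),
        SAW.law D.carrier δ (a δ) (b δ)
            {γ | ∃ (w : Site 2) (hw : w ∈ γ.walk.support),
              (∀ v ∈ (γ.walk.takeUntil w hw).support, r ≤ dist (meshPoint δ v) z) ∧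
              ε < |condRoom D.carrier δ (a δ) (b δ) (zδ δ) (γ.walk.takeUntil w hw)
                    - roomAt D.carrier δ (verts (γ.walk.takeUntil w hw)) (zδ δ)
                    + (2 / Real.pi) * roomProfile (sideAngle D δ (γ.walk.takeUntil w hw) (zδ δ) z)|}
          ≤ ENNReal.ofReal ε) →
    (∀ (D : DobrushinDomain) (a b : ℝ → Site 2), SAW.IsEndpointApprox D a b →
      ∀ z ∈ D.carrier, ∀ (zδ : ℝ → Site 2),
        Tendsto (fun δ => meshPoint δ (zδ δ)) (𝓝[>] (0 : ℝ)) (𝓝 z) →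
      ∀ ε : ℝ, 0 < ε → ∃ R : ℝ, ∀ᶠ δ in 𝓝[>] (0 : ℝ),
        ∫ γ in {γ : SAW.DomainSAW D.carrier δ (a δ) (b δ) |
                  R < roomAt D.carrier δ ∅ (zδ δ) - roomAt D.carrier δ (verts γ.walk) (zδ δ)},
            (roomAt D.carrier δ ∅ (zδ δ) - roomAt D.carrier δ (verts γ.walk) (zδ δ))
          ∂(SAW.law D.carrier δ (a δ) (b δ)) ≤ ε) →
    ∀ (D : DobrushinDomain) (a b : ℝ → Site 2) (φ : ConformalEquiv upperHalfPlaneSet D.carrier),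
      SAW.IsEndpointApprox D a b → D.IsChordalUniformizing φ →
      ∀ w : ℂ, 0 < w.im → ∀ (zδ : ℝ → Site 2),
        Tendsto (fun δ => meshPoint δ (zδ δ)) (𝓝[>] (0 : ℝ)) (𝓝 (φ w)) →
      (∀ ε : ℝ, 0 < ε → ∃ R : ℝ, ∀ᶠ δ in 𝓝[>] (0 : ℝ),
        ∫ γ in {γ : SAW.DomainSAW D.carrier δ (a δ) (b δ) |
                  R < roomAt D.carrier δ ∅ (zδ δ) - roomAt D.carrier δ (verts γ.walk) (zδ δ)},
            (roomAt D.carrier δ ∅ (zδ δ) - roomAt D.carrier δ (verts γ.walk) (zδ δ))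
          ∂(SAW.law D.carrier δ (a δ) (b δ)) ≤ ε) ∧
      ∀ ε : ℝ, 0 < ε → ∃ R : ℝ, 0 < R ∧ ∀ r : ℝ, 0 < r → r < R → ∀ᶠ δ in 𝓝[>] (0 : ℝ),
        SAW.law D.carrier δ (a δ) (b δ) (roomDataEventPos D φ δ (a δ) (b δ) (zδ δ) w R r ε)
          ≤ ENNReal.ofReal ε := by
  sorry

/-- STUB N (r7; LANDED p118403). `LimitsDescribable → SAWNoReturn`: lattice reversal symmetry
(`SAW.map_sawReverse_law`, `isEndpointApprox_swap`, `Negative/ReversalLattice` p81553), a chordal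
uniformizing map of `D.swap`, `LimitsDescribable` there for the reversed weak limit
(`Measure.map CurveClass.reverse μ`), "a described class reaches its target only at the final time"
(`IsCompactifiedImage`, injectivity of the boundary extension), hence `μ`-a.e. class visits `a` only at
time `0`; portmanteau on the closed no-return events (`measure_compl_le_of_tendsto_of_isClosed`). -/
theorem stub_sawNoReturn :
    LimitsDescribable →
    ∀ (D : DobrushinDomain) (a b : ℝ → Site 2), SAW.IsEndpointApprox D a b →
      ∀ (μ : Measure (CurveClass ℂ)) (s : ℕ → ℝ), IsProbabilityMeasure μ →
        Tendsto s atTop (𝓝[>] (0 : ℝ)) → WeakLimitAlong D a b μ s → NoReturnAlong D a b s :=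
  Summit.CriticalPhenomena.SAWScalingLimit.Theorems.SubseqIdentification.RoomEntropy.stub_sawNoReturn

/-- STUB 7b3 (r8; few lines over the LANDED r7 assembly p119422, route (ii) diagonalisation).
`SAWLatticeDriversApprox → LatticeRoomDataNRPos → SAWNoReturn → RoomMartingaleLimitCap`: p119422's
`exists_explorationData` with `roomDataEventPos` — thread `0 < S₀` (`hS₀.trans_le (hSL.trans hLf)`) and drop the
`k ≤ n` binder (`fun i k hik _ hR ↦ hnr i k hik hR`). Original plan of p119422:
the r6b assembly (p114096) re-run per tolerance `ρ` with the frozen limit driver `frozenDriver φ S₀(ρ)`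
(running-max capacity clock in `SAW.exists_explorationFiltration`; first passages of levels `≥ S₀`; bad
event = `capacityEvent ∪ roomDataEvent ∪ fidelityEvent ∪ noReturnEvent`), the passage theorem with `O(ρ)`
defects (corollary of the proof of p101958) or diagonalisation in `ρ`, then `ρ → 0`
(`frozenDriver φ S₀ c → drivingPath` locally uniformly; continuity of the capped functional p99035;
dominated convergence), the frozen extension beyond `(Im w)²/16` (p108629) and the natural filtration
step (`exists_filtration_martingale_roomObsCap_of_integral_cylinder`, p114096). -/
theorem stub_roomPassageAssemblyNRPos :
    (∀ (D : DobrushinDomain) (a b : ℝ → Site 2) (φ : ConformalEquiv upperHalfPlaneSet D.carrier),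
      SAW.IsEndpointApprox D a b → D.IsChordalUniformizing φ →
      ∀ ρ : ℝ, 0 < ρ → ∀ (μ : Measure (CurveClass ℂ)) (s : ℕ → ℝ) [IsProbabilityMeasure μ]
        [∀ n, IsProbabilityMeasure (SAW.law D.carrier (s n) (a (s n)) (b (s n)))],
        Tendsto s atTop (𝓝[>] (0 : ℝ)) → WeakLimitAlong D a b μ s →
        (∀ᵐ c ∂μ, IsLoewnerDescribable φ c ∧ c.source = D.pt 0) → NoReturnAlong D a b s →
        ∃ S₀ : ℝ≥0, 0 < S₀ ∧ (S₀ : ℝ) ≤ ρ ∧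
        ∃ 𝒱 : (δ : ℝ) → SAW.DomainSAW D.carrier δ (a δ) (b δ) → C(ℝ≥0, ℝ),
          (∀ᶠ n in atTop, ∀ (γ γ' : SAW.DomainSAW D.carrier (s n) (a (s n)) (b (s n))) (k : ℕ),
            (prefixAt γ k).support = (prefixAt γ' k).support →
            (S₀ : ℝ) ≤ LatticeSlit.capTime φ (prefixAt γ k) →
            ∀ u : ℝ≥0, (u : ℝ) ≤ LatticeSlit.capTime φ (prefixAt γ k) →
              𝒱 (s n) γ u = 𝒱 (s n) γ' u) ∧
          TendstoInDistribution (fun n γ => 𝒱 (s n) γ) atTop (frozenDriver φ S₀)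
            (fun n => SAW.law D.carrier (s n) (a (s n)) (b (s n))) μ ∧
          (∀ w : ℂ, ρ ≤ w.im → ∀ᶠ n in atTop,
            SAW.law D.carrier (s n) (a (s n)) (b (s n)) (fidelityEvent φ (𝒱 (s n)) S₀ w ρ)
              ≤ ENNReal.ofReal ρ) ∧
          ∀ T ε : ℝ, 0 < ε → ∀ᶠ n in atTop,
            SAW.law D.carrier (s n) (a (s n)) (b (s n)) (capacityEvent φ T ε) ≤ ENNReal.ofReal ε) →
    (∀ (D : DobrushinDomain) (a b : ℝ → Site 2) (φ : ConformalEquiv upperHalfPlaneSet D.carrier),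
      SAW.IsEndpointApprox D a b → D.IsChordalUniformizing φ →
      ∀ w : ℂ, 0 < w.im → ∀ (zδ : ℝ → Site 2),
        Tendsto (fun δ => meshPoint δ (zδ δ)) (𝓝[>] (0 : ℝ)) (𝓝 (φ w)) →
      (∀ ε : ℝ, 0 < ε → ∃ R : ℝ, ∀ᶠ δ in 𝓝[>] (0 : ℝ),
        ∫ γ in {γ : SAW.DomainSAW D.carrier δ (a δ) (b δ) |
                  R < roomAt D.carrier δ ∅ (zδ δ) - roomAt D.carrier δ (verts γ.walk) (zδ δ)},
            (roomAt D.carrier δ ∅ (zδ δ) - roomAt D.carrier δ (verts γ.walk) (zδ δ))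
          ∂(SAW.law D.carrier δ (a δ) (b δ)) ≤ ε) ∧
      ∀ ε : ℝ, 0 < ε → ∃ R : ℝ, 0 < R ∧ ∀ r : ℝ, 0 < r → r < R → ∀ᶠ δ in 𝓝[>] (0 : ℝ),
        SAW.law D.carrier δ (a δ) (b δ) (roomDataEventPos D φ δ (a δ) (b δ) (zδ δ) w R r ε)
          ≤ ENNReal.ofReal ε) →
    (∀ (D : DobrushinDomain) (a b : ℝ → Site 2), SAW.IsEndpointApprox D a b →
      ∀ (μ : Measure (CurveClass ℂ)) (s : ℕ → ℝ), IsProbabilityMeasure μ →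
        Tendsto s atTop (𝓝[>] (0 : ℝ)) → WeakLimitAlong D a b μ s → NoReturnAlong D a b s) →
    ∀ (D : DobrushinDomain) (a b : ℝ → Site 2)
      (φ : ConformalEquiv upperHalfPlaneSet D.carrier) (μ : Measure (CurveClass ℂ)),
      SAW.IsEndpointApprox D a b → D.IsChordalUniformizing φ → IsProbabilityMeasure μ →
      IsSubseqLimitLaw (fun δ (γ : SAW.DomainSAW D.carrier δ (a δ) (b δ)) => γ.curve)
        (fun δ => SAW.law D.carrier δ (a δ) (b δ)) μ →
      (∀ᵐ c ∂μ, IsLoewnerDescribable φ c ∧ c.source = D.pt 0) →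
      ∃ 𝓕 : Filtration ℝ≥0 (inferInstance : MeasurableSpace (CurveClass ℂ)),
        Adapted 𝓕 (fun t c => drivingFunction φ c t) ∧
        ∀ w : ℂ, 0 < w.im →
          Martingale (fun t c => roomObsStopped (drivingFunction φ c) w ⌈w.im ^ 2 / 16⌉₊ (min t (Real.toNNReal (w.im ^ 2 / 16)))) 𝓕 μ := by
  sorry

/-! ## Landed stubs (closed by name) -/

/-- STUB 4' (r6; LANDED p105444). The capped endgame. -/
theorem stub_roomEntropyCharacterisesSLECap :
    ∀ (D : DobrushinDomain) (φ : ConformalEquiv upperHalfPlaneSet D.carrier)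
      (ν : Measure (CurveClass ℂ)),
      D.IsChordalUniformizing φ → IsProbabilityMeasure ν →
      (∀ᵐ c ∂ν, IsLoewnerDescribable φ c ∧ c.source = D.pt 0) →
      ∀ 𝓕 : Filtration ℝ≥0 (inferInstance : MeasurableSpace (CurveClass ℂ)),
        Adapted 𝓕 (fun t c => drivingFunction φ c t) →
        (∀ w : ℂ, 0 < w.im →
          Martingale (fun t c => roomObsStopped (drivingFunction φ c) w ⌈w.im ^ 2 / 16⌉₊ (min t (Real.toNNReal (w.im ^ 2 / 16)))) 𝓕 ν) →
      IsSLELaw ((8 : ℝ≥0) / 3) D ν :=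
  Summit.CriticalPhenomena.SAWScalingLimit.Theorems.SubseqIdentification.RoomEntropy.stub_roomEntropyCharacterisesSLECap

/-! ## Consistency: each named statement IS its registered stub (definitionally) -/

theorem roomLawSlit_holds : RoomLawSlit := stub_roomLawSlit
theorem roomDeficitUI_holds : RoomDeficitUI := stub_roomDeficitUI
theorem latticePotentialFacts_holds : LatticePotentialFacts := stub_latticePotentialFacts
theorem degeneratePastCapacity_holds : DegeneratePastCapacity := stub_degeneratePastCapacity
theorem sawLatticeDriversApprox_holds : SAWLatticeDriversApprox := stub_sawLatticeDriversApprox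
theorem latticeRoomDataNRPos_holds :
    LatticePotentialFacts → DegeneratePastCapacity → RoomLawSlit → RoomDeficitUI → LatticeRoomDataNRPos :=
  fun hF hJ => stub_latticeRoomDataNR hF.1 hF.2.1 hF.2.2 hJ
theorem sawNoReturn_holds : LimitsDescribable → SAWNoReturn := stub_sawNoReturn
theorem roomPassageAssemblyNRPos_holds :
    SAWLatticeDriversApprox → LatticeRoomDataNRPos → SAWNoReturn → RoomMartingaleLimitCap :=
  stub_roomPassageAssemblyNRPos
theorem roomEntropyCharacterisesSLECap_holds : RoomEntropyCharacterisesSLECap :=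
  stub_roomEntropyCharacterisesSLECap
/-- The transfer as a COMPOSITE of the r8 stubs. -/
theorem roomMartingaleLimitCap_holds (hR : LimitsDescribable) :
    RoomLawSlit → RoomDeficitUI → RoomMartingaleLimitCap :=
  fun hL hU => roomPassageAssemblyNRPos_holds sawLatticeDriversApprox_holds
    (latticeRoomDataNRPos_holds latticePotentialFacts_holds degeneratePastCapacity_holds hL hU) (sawNoReturn_holds hR)

/-! ## Composition (sorry-free): the stubs and the shared item `LimitsDescribable` prove the crux BY NAME -/

/-- The SHAPE of the line as one proposition (r7). -/
def LineShape : Prop :=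
  RoomLawSlit → RoomDeficitUI → (LimitsDescribable → RoomLawSlit → RoomDeficitUI → RoomMartingaleLimitCap) →
    RoomEntropyCharacterisesSLECap → LimitsDescribable → SubseqIdentification

/-- **The kernel-checked composition**: `μ` is a probability subsequential limit law of the SAW curve laws
(`IsSubseqLimitLaw`, witnessed by the given `s`); `LimitsDescribable` makes `μ`-a.e. class describable from
`a` (and feeds the no-return input); the transfer gives the capped natural-filtration martingales; the
capped endgame identifies `μ`. -/
theorem lineShape_holds : LineShape := by
  intro hL hU hT hI hR D a b hab s μ hs hμ hlim
  have hsub : IsSubseqLimitLaw (fun δ (γ : SAW.DomainSAW D.carrier δ (a δ) (b δ)) => γ.curve)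
      (fun δ => SAW.law D.carrier δ (a δ) (b δ)) μ := ⟨s, hs, hlim⟩
  obtain ⟨φ, hφ⟩ := MarkedDomain.exists_isChordalUniformizing_holds D
  have hdesc := hR D a b hab φ hφ μ hμ hsub
  obtain ⟨𝓕, hW, hN⟩ := hT hR hL hU D a b φ μ hab hφ hμ hsub hdesc
  exact hI D φ μ hφ hμ hdesc 𝓕 hW hN

/-- **`SubseqIdentification` from the registered stubs and the shared route item
`SAWLaplacianWalk.LimitsDescribable` (stmt-CriticalPhenomena-4481, BY NAME)** — the skeleton theorem
audited by `#h21_check_skeleton`: concludes the route decl BY NAME; `sorry` enters only through `stub_*`. -/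
theorem SubseqIdentification_of (hR : LimitsDescribable) : SubseqIdentification :=
  lineShape_holds stub_roomLawSlit stub_roomDeficitUI roomMartingaleLimitCap_holds
    stub_roomEntropyCharacterisesSLECap hR

/-- The same skeleton theorem for the decl of the FIRST route wanting the shared crux
(`SAWParafermion.SubseqIdentification`, identical statement text). -/
theorem SubseqIdentification_of' (hR : LimitsDescribable) :
    Summit.CriticalPhenomena.SAWScalingLimit.Theses.SAWParafermion.SubseqIdentification :=
  SubseqIdentification_of hR

end Summit.CriticalPhenomena.SAWScalingLimit.Cruxes.SubseqIdentification.RoomEntropyWrightFisher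

end
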